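import Summits.NavierStokesRegularity.NavierStokesRegularity.Theorems.StrainDoorsVorticityRecord
import Literature.Analysis.FluidPDE.ScalingUniformRecurrence
import HarnessLib

/-!
# StrainDoorsDSSRecords — THE RECORDS OF A DISCRETELY SELF-SIMILAR SINGULARITY

nsreg-p1 g35, ROUND-53 PART 2 (helper lane of `stmt-NavierStokesRegularity-0056`, rung N0; lands after PART 1
`StrainDoorsVorticityRecord`).

The record laws of ROUND-52/53 are conditional on a record being ATTAINED.  For a `c`-discretely self-similar
(`c > 1`) classical solution on `(−∞,0) × ℝ³` — the canonical blow-up candidate (`u(t,x) = c·u(c²t, cx)`; the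
self-similar case is `c`-DSS for every `c`) — whose velocity GRADIENT tends to zero at spatial infinity uniformly over
one period `t ∈ [−c², −1]`, attainment is FREE:  the strain number `N = (0 − t)·q(t,x,e)` and the vorticity number
`W = (0 − t)·|ω(t,x)|` are invariant under the period map `(t,x) ↦ (c²t, cx)` (`dss_strainNumber_zpow`,
`dss_vorticityNumber_zpow`), every `(t,x)` has a representative in the compact period cylinder
`[−c², −1] × B̄_R` up to a far field where `N, W` are small (`exists_dss_period_rep` + decay), so

* §2 ★★ `dss_strainNumber_attained` / `dss_vorticityNumber_attained` — the space-time suprema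
  `N* = sup_{t<0,x,|e|=1} (0 − t)q` and `W* = sup_{t<0,x} (0 − t)|ω|` of a non-trivial DSS solution ARE ATTAINED
  (at some `t* < 0`, `x*`, unit `e*`, resp. `t_ω < 0`, `x_ω`).

PART 3 (`StrainDoorsDSSRecordLaws`) then reads the one-point laws of ROUND-52/53 at the ATTAINED records, blow-up time
`T = 0`, UNCONDITIONALLY on this class: `dss_strain_record_law` (`N* + N*² + ν t*²(−Δq) ≤ t*²·H`, `1 ≤ ((H − q²)/q²)·N*`
— referee R52 F4), `dss_vorticity_record_law` (`1 ≤ (0 − t_ω)(α − ν|∇ξ|²_F)`), `dss_strainNumber_floor` (every majorant of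
the strain number is `≥ 1 + ν(0 − t_ω)|∇ξ(t_ω,x_ω)|²_F`).

* §1 `periodGradDecay_of_typeI_grad` — the decay hypothesis follows from a Type-I GRADIENT bound
  `|∇u(t,x)| ≤ C/(|x| + √(−t))²` (the gradient form of the Chae–Wolf 2017 Thm 1.1 estimate `|u| ≤ C/(|x|+√(−t))`,
  `Literature…chaeWolf2017_dss_typeI_decay`).

WHAT THIS IS NOT: no DSS profile is excluded (`TypeIDSSLiouville`, Bradshaw–Tsai Open Problem 5.1, stays open);
`0056`/NS regularity are not proved.  These are exact necessary conditions every DSS blow-up profile satisfies at two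
computable points — a test any proposed (numerical) DSS/SS profile must pass.  No new definitions; no sorry.
hard core evaded: NONE CLAIMED.
[cite: ChaeWolf2017RemovingDSS, Theorem 1.1 (arXiv:1610.09464 p. 3); BradshawTsai2017CPDE, §5 Open Problem 5.1;
GalantiGibbonHeritage1997, §3 (arXiv:chao-dyn/9709003 p. 7)]
-/

noncomputable section

open MeasureTheory Set Function Filter Metric Real InnerProductSpace
open _root_.Topology
open scoped ENNReal NNReal RealInnerProductSpace ContDiff Laplacian
open Literature.Analysis Literature.Analysis.FluidPDE
open Literature.Analysis.FluidPDE.VorticityDirectionDynamics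

set_option linter.dupNamespace false

namespace Summit.NavierStokesRegularity.NavierStokesRegularity.Theorems.StrainDoors

open Summit.NavierStokesRegularity.NavierStokesRegularity.Theorems.ArgmaxDoors

set_option maxSynthPendingDepth 3

/-! ## §1 DSS period calculus and the decay hypothesis -/

/-- **Period representative.**  `c > 1`, `t < 0`: some `n : ℤ` puts `(cⁿ)²·t` in the fundamental period
`(−c², −1]`.  (Take `m` with `c^m ≤ √(−t) < c^{m+1}` and `n = −m`.) [folklore] -/
theorem exists_dss_period_rep {c : ℝ} (hc : 1 < c) {t : ℝ} (ht : t < 0) :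
    ∃ n : ℤ, -(c ^ 2) < (c ^ n) ^ 2 * t ∧ (c ^ n) ^ 2 * t ≤ -1 := by
  have hc0 : 0 < c := one_pos.trans hc
  have hr0 : 0 < Real.sqrt (-t) := Real.sqrt_pos.mpr (by linarith)
  obtain ⟨m, hm1, hm2⟩ := exists_mem_Ico_zpow hr0 hc
  have hcm : 0 < c ^ m := zpow_pos hc0 m
  refine ⟨-m, ?_, ?_⟩
  · -- `(c^{-m})² t > -c²  ⇔  -t < c² (c^m)²  ⇐  √(-t) < c^{m+1} = c^m c`
    have h1 : Real.sqrt (-t) < c ^ m * c := by rwa [zpow_add_one₀ hc0.ne'] at hm2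
    have h2 : -t < (c ^ m * c) ^ 2 := by
      have := pow_lt_pow_left₀ h1 hr0.le two_ne_zero
      rwa [Real.sq_sqrt (by linarith)] at this
    have h3 : (c ^ (-m)) ^ 2 * t = t / (c ^ m) ^ 2 := by
      rw [zpow_neg]; field_simp
    rw [h3, neg_lt, neg_div', div_lt_iff₀ (pow_pos hcm 2)]
    nlinarith [h2]
  · -- `(c^{-m})² t ≤ -1  ⇔  (c^m)² ≤ -t  ⇐  c^m ≤ √(-t)`
    have h2 : (c ^ m) ^ 2 ≤ -t := by
      have := pow_le_pow_left₀ hcm.le hm1 2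
      rwa [Real.sq_sqrt (by linarith)] at this
    have h3 : (c ^ (-m)) ^ 2 * t = t / (c ^ m) ^ 2 := by
      rw [zpow_neg]; field_simp
    rw [h3, div_le_iff₀ (pow_pos hcm 2)]
    linarith

/-- **DSS scaling of the vorticity**: `ω(t,x) = c²·ω(c²t, cx)` for a `c`-DSS field. [folklore] -/
theorem dss_curl_eq {c : ℝ} {u : ℝ → (EuclideanSpace ℝ (Fin 3)) → (EuclideanSpace ℝ (Fin 3))}
    (h : IsDiscretelySelfSimilar c u) (t : ℝ) (x : EuclideanSpace ℝ (Fin 3)) :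
    curl (u t) x = c ^ 2 • curl (u (c ^ 2 * t)) (c • x) := by
  have key : u t = fun y => c • u (c ^ 2 * t) (c • y) := (congrFun h t).symm
  rw [curl_eq_curlCLM, key, fderiv_smul_comp_smul, map_smul]
  rfl

/-- **The vorticity number is DSS-invariant**: `(0 − t)|ω(t,x)| = (0 − c²t)|ω(c²t, cx)|`. [folklore] -/
theorem dss_vorticityNumber_eq {c : ℝ} {u : ℝ → (EuclideanSpace ℝ (Fin 3)) → (EuclideanSpace ℝ (Fin 3))}
    (h : IsDiscretelySelfSimilar c u) (t : ℝ) (x : EuclideanSpace ℝ (Fin 3)) :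
    (0 - t) * ‖curl (u t) x‖ = (0 - c ^ 2 * t) * ‖curl (u (c ^ 2 * t)) (c • x)‖ := by
  rw [dss_curl_eq h t x, norm_smul, Real.norm_of_nonneg (sq_nonneg c)]
  ring

/-- Period transport of the strain number along the powers of the scaling factor. [folklore] -/
theorem dss_strainNumber_zpow {c : ℝ} (hc : c ≠ 0)
    {u : ℝ → (EuclideanSpace ℝ (Fin 3)) → (EuclideanSpace ℝ (Fin 3))}
    (h : IsDiscretelySelfSimilar c u) (n : ℤ) (t : ℝ) (x e : EuclideanSpace ℝ (Fin 3)) :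
    (0 - t) * strainQuad u t x e =
      (0 - (c ^ n) ^ 2 * t) * strainQuad u ((c ^ n) ^ 2 * t) ((c ^ n) • x) e :=
  (h.zpow hc n).strainNumber_eq t x e

/-- Period transport of the vorticity number along the powers of the scaling factor. [folklore] -/
theorem dss_vorticityNumber_zpow {c : ℝ} (hc : c ≠ 0)
    {u : ℝ → (EuclideanSpace ℝ (Fin 3)) → (EuclideanSpace ℝ (Fin 3))}
    (h : IsDiscretelySelfSimilar c u) (n : ℤ) (t : ℝ) (x : EuclideanSpace ℝ (Fin 3)) :
    (0 - t) * ‖curl (u t) x‖ = (0 - (c ^ n) ^ 2 * t) * ‖curl (u ((c ^ n) ^ 2 * t)) ((c ^ n) • x)‖ :=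
  dss_vorticityNumber_eq (h.zpow hc n) t x

/-- **The decay hypothesis from a Type-I gradient bound.**  If `|∇u(t,x)| ≤ C/(|x| + √(−t))²` for all `t < 0`, `x`
(the gradient form of the Chae–Wolf Type-I estimate for DSS solutions), then `∇u → 0` at spatial infinity uniformly on
the period `t ∈ [−c², −1]` (indeed uniformly in `t < 0`). [folklore] -/
theorem periodGradDecay_of_typeI_grad {c C : ℝ}
    {u : ℝ → (EuclideanSpace ℝ (Fin 3)) → (EuclideanSpace ℝ (Fin 3))}
    (hgrad : ∀ t : ℝ, t < 0 → ∀ x : EuclideanSpace ℝ (Fin 3),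
      ‖fderiv ℝ (u t) x‖ ≤ C / (‖x‖ + Real.sqrt (0 - t)) ^ 2) :
    ∀ ε : ℝ, 0 < ε → ∃ R : ℝ, ∀ t ∈ Icc (-(c ^ 2)) (-1), ∀ x : EuclideanSpace ℝ (Fin 3),
      R ≤ ‖x‖ → ‖fderiv ℝ (u t) x‖ ≤ ε := by
  intro ε hε
  refine ⟨max 1 (C / ε), fun t ht x hx => ?_⟩
  have ht0 : t < 0 := lt_of_le_of_lt ht.2 (by norm_num)
  have hx1 : 1 ≤ ‖x‖ := (le_max_left _ _).trans hx
  have hxC : C / ε ≤ ‖x‖ := (le_max_right _ _).trans hx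
  have hsq : 0 ≤ Real.sqrt (0 - t) := Real.sqrt_nonneg _
  have hD : ‖x‖ ≤ (‖x‖ + Real.sqrt (0 - t)) ^ 2 := by nlinarith [hx1, hsq]
  have hDpos : 0 < (‖x‖ + Real.sqrt (0 - t)) ^ 2 := by positivity
  refine (hgrad t ht0 x).trans ?_
  by_cases hC : 0 ≤ C
  · calc C / (‖x‖ + Real.sqrt (0 - t)) ^ 2 ≤ C / ‖x‖ := by
          exact div_le_div_of_nonneg_left hC (by linarith) hD
      _ ≤ ε := by
          rw [div_le_iff₀ (by linarith)]
          have := (div_le_iff₀ hε).mp hxC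
          linarith
  · push Not at hC
    exact (div_neg_of_neg_of_pos hC hDpos).le.trans hε.le

/-! ## §2 Attainment of the strain number and of the vorticity number on the DSS class -/

/-- ★★ **THE STRAIN NUMBER OF A DSS FIELD IS ATTAINED.**  `u` jointly smooth on `(−∞,0) × ℝ³`, `c`-DSS (`c > 1`),
gradient decaying at spatial infinity uniformly over the period `[−c², −1]`, and with positive strain somewhere.  Then the
space-time supremum of the strain number `(0 − t)·q(t,x,e)` over `t < 0`, `x`, unit `e` is ATTAINED: some `t* < 0`,
`x*`, unit `e*` with `q(t*,x*,e*) > 0` dominate every `(s,y,e')`. [folklore] -/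
theorem dss_strainNumber_attained {c : ℝ} (hc : 1 < c)
    {u : ℝ → (EuclideanSpace ℝ (Fin 3)) → (EuclideanSpace ℝ (Fin 3))}
    (hsm : IsSmoothSpaceTimeOn (Iio 0) u) (hdss : IsDiscretelySelfSimilar c u)
    (hdecay : ∀ ε : ℝ, 0 < ε → ∃ R : ℝ, ∀ t ∈ Icc (-(c ^ 2)) (-1), ∀ x : EuclideanSpace ℝ (Fin 3),
      R ≤ ‖x‖ → ‖fderiv ℝ (u t) x‖ ≤ ε)
    (hpos : ∃ t₀ : ℝ, t₀ < 0 ∧ ∃ x₀ e₀ : EuclideanSpace ℝ (Fin 3), ‖e₀‖ = 1 ∧ 0 < strainQuad u t₀ x₀ e₀) :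
    ∃ t : ℝ, t < 0 ∧ ∃ x e : EuclideanSpace ℝ (Fin 3), ‖e‖ = 1 ∧ 0 < strainQuad u t x e ∧
      ∀ s : ℝ, s < 0 → ∀ y e' : EuclideanSpace ℝ (Fin 3), ‖e'‖ = 1 →
        (0 - s) * strainQuad u s y e' ≤ (0 - t) * strainQuad u t x e := by
  have hc0 : 0 < c := one_pos.trans hc
  have hc2 : 0 < c ^ 2 := pow_pos hc0 2
  obtain ⟨t₀, ht₀, x₀, e₀, he₀, hq₀⟩ := hpos
  obtain ⟨N₀, hN₀⟩ : ∃ N₀ : ℝ, N₀ = (0 - t₀) * strainQuad u t₀ x₀ e₀ := ⟨_, rfl⟩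
  have hN₀pos : 0 < N₀ := by rw [hN₀]; exact mul_pos (by linarith) hq₀
  obtain ⟨R, hR⟩ := hdecay (N₀ / (2 * c ^ 2)) (by positivity)
  -- Rayleigh quotient bound `q ≤ |∇u|` for unit directions
  have hray : ∀ (s : ℝ) (y e' : EuclideanSpace ℝ (Fin 3)), ‖e'‖ = 1 →
      strainQuad u s y e' ≤ ‖fderiv ℝ (u s) y‖ := by
    intro s y e' he'
    unfold strainQuad
    calc ⟪fderiv ℝ (u s) y e', e'⟫ ≤ ‖fderiv ℝ (u s) y e'‖ * ‖e'‖ := real_inner_le_norm _ _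
      _ ≤ ‖fderiv ℝ (u s) y‖ * ‖e'‖ * ‖e'‖ := by
          gcongr; exact ContinuousLinearMap.le_opNorm _ _
      _ = ‖fderiv ℝ (u s) y‖ := by rw [he', mul_one, mul_one]
  -- far field: the strain number is at most `N₀/2` outside the ball on the period
  have hout : ∀ s ∈ Icc (-(c ^ 2)) (-1), ∀ (y e' : EuclideanSpace ℝ (Fin 3)), ‖e'‖ = 1 → R ≤ ‖y‖ →
      (0 - s) * strainQuad u s y e' ≤ N₀ / 2 := by
    intro s hs y e' he' hy
    have h1 : strainQuad u s y e' ≤ N₀ / (2 * c ^ 2) := (hray s y e' he').trans (hR s hs y hy)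
    have hs0 : 0 ≤ 0 - s := by linarith [hs.2]
    have hs2 : 0 - s ≤ c ^ 2 := by linarith [hs.1]
    calc (0 - s) * strainQuad u s y e' ≤ (0 - s) * (N₀ / (2 * c ^ 2)) := mul_le_mul_of_nonneg_left h1 hs0
      _ ≤ c ^ 2 * (N₀ / (2 * c ^ 2)) := mul_le_mul_of_nonneg_right hs2 (by positivity)
      _ = N₀ / 2 := by field_simp
  -- period representatives
  have hrep : ∀ s : ℝ, s < 0 → ∀ (y e' : EuclideanSpace ℝ (Fin 3)),
      ∃ s' ∈ Icc (-(c ^ 2)) (-1), ∃ y' : EuclideanSpace ℝ (Fin 3),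
        (0 - s) * strainQuad u s y e' = (0 - s') * strainQuad u s' y' e' := by
    intro s hs y e'
    obtain ⟨n, hn1, hn2⟩ := exists_dss_period_rep hc hs
    exact ⟨(c ^ n) ^ 2 * s, ⟨hn1.le, hn2⟩, (c ^ n) • y, dss_strainNumber_zpow hc0.ne' hdss n s y e'⟩
  -- the compact period cylinder × unit sphere, and the continuous strain number on it
  obtain ⟨K, hK⟩ : ∃ K : Set (ℝ × EuclideanSpace ℝ (Fin 3) × EuclideanSpace ℝ (Fin 3)),
      K = Icc (-(c ^ 2)) (-1) ×ˢ (closedBall (0 : EuclideanSpace ℝ (Fin 3)) R ×ˢ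
        sphere (0 : EuclideanSpace ℝ (Fin 3)) 1) := ⟨_, rfl⟩
  have hKc : IsCompact K := by
    rw [hK]; exact isCompact_Icc.prod ((isCompact_closedBall _ _).prod (isCompact_sphere _ _))
  have hmemK : ∀ {s : ℝ} {y e' : EuclideanSpace ℝ (Fin 3)}, s ∈ Icc (-(c ^ 2)) (-1) → ‖y‖ ≤ R →
      ‖e'‖ = 1 → (s, y, e') ∈ K := by
    intro s y e' hs hy he'
    rw [hK]
    exact mk_mem_prod hs (mk_mem_prod (mem_closedBall_zero_iff.mpr hy) (mem_sphere_zero_iff_norm.mpr he'))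
  have hKsub : ∀ {z : ℝ × EuclideanSpace ℝ (Fin 3) × EuclideanSpace ℝ (Fin 3)}, z ∈ K →
      z.1 ∈ Icc (-(c ^ 2)) (-1) ∧ ‖z.2.1‖ ≤ R ∧ ‖z.2.2‖ = 1 := by
    intro z hz
    rw [hK] at hz
    obtain ⟨h1, h2, h3⟩ := mem_prod.mp hz |>.imp_right mem_prod.mp |> fun h => (⟨h.1, h.2.1, h.2.2⟩ :
      z.1 ∈ Icc (-(c ^ 2)) (-1) ∧ z.2.1 ∈ closedBall (0 : EuclideanSpace ℝ (Fin 3)) R ∧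
        z.2.2 ∈ sphere (0 : EuclideanSpace ℝ (Fin 3)) 1)
    exact ⟨h1, mem_closedBall_zero_iff.mp h2, mem_sphere_zero_iff_norm.mp h3⟩
  have hψc : ContinuousOn (fun z : ℝ × EuclideanSpace ℝ (Fin 3) × EuclideanSpace ℝ (Fin 3) =>
      (0 - z.1) * ⟪fderiv ℝ (u z.1) z.2.1 z.2.2, z.2.2⟫) K := by
    have hW := (hsm.fderiv_slice (uniqueDiffOn_Iio 0)).continuousOn
    have h2 : ContinuousOn (fun z : ℝ × EuclideanSpace ℝ (Fin 3) × EuclideanSpace ℝ (Fin 3) =>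
        (z.1, z.2.1)) K := by fun_prop
    have hWc : ContinuousOn (fun z : ℝ × EuclideanSpace ℝ (Fin 3) × EuclideanSpace ℝ (Fin 3) =>
        fderiv ℝ (u z.1) z.2.1) K := by
      refine hW.comp h2 fun z hz => mk_mem_prod ?_ (mem_univ _)
      exact lt_of_le_of_lt (hKsub hz).1.2 (by norm_num)
    have hev : ContinuousOn (fun z : ℝ × EuclideanSpace ℝ (Fin 3) × EuclideanSpace ℝ (Fin 3) =>
        fderiv ℝ (u z.1) z.2.1 z.2.2) K :=
      isBoundedBilinearMap_apply.continuous.comp_continuousOn (hWc.prodMk (by fun_prop))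
    have hin : ContinuousOn (fun z : ℝ × EuclideanSpace ℝ (Fin 3) × EuclideanSpace ℝ (Fin 3) =>
        ⟪fderiv ℝ (u z.1) z.2.1 z.2.2, z.2.2⟫) K := hev.inner (by fun_prop)
    exact (by fun_prop : Continuous fun z : ℝ × EuclideanSpace ℝ (Fin 3) × EuclideanSpace ℝ (Fin 3) =>
      (0 : ℝ) - z.1).continuousOn.mul hin
  -- the representative of the positive point lies in `K`
  obtain ⟨s₀, hs₀, y₀, hN₀eq⟩ := hrep t₀ ht₀ x₀ e₀
  have hy₀ : ‖y₀‖ ≤ R := by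
    by_contra hcon
    push Not at hcon
    have := hout s₀ hs₀ y₀ e₀ he₀ hcon.le
    rw [← hN₀eq, ← hN₀] at this
    linarith
  have h0K : (s₀, y₀, e₀) ∈ K := hmemK hs₀ hy₀ he₀
  obtain ⟨z, hzK, hmax⟩ := hKc.exists_isMaxOn ⟨(s₀, y₀, e₀), h0K⟩ hψc
  obtain ⟨htI, -, he⟩ := hKsub hzK
  have ht : z.1 < 0 := lt_of_le_of_lt htI.2 (by norm_num)
  have hN₀le : N₀ ≤ (0 - z.1) * strainQuad u z.1 z.2.1 z.2.2 := by
    have := isMaxOn_iff.mp hmax (s₀, y₀, e₀) h0K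
    rw [hN₀, hN₀eq]; exact this
  refine ⟨z.1, ht, z.2.1, z.2.2, he, ?_, ?_⟩
  · by_contra hq
    push Not at hq
    have : (0 - z.1) * strainQuad u z.1 z.2.1 z.2.2 ≤ 0 := mul_nonpos_of_nonneg_of_nonpos (by linarith) hq
    linarith
  · intro s hs y e' he'
    obtain ⟨s', hs', y', hEq⟩ := hrep s hs y e'
    rw [hEq]
    by_cases hy : ‖y'‖ ≤ R
    · exact isMaxOn_iff.mp hmax (s', y', e') (hmemK hs' hy he')
    · push Not at hy
      exact ((hout s' hs' y' e' he' hy.le).trans (by linarith)).trans hN₀le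

/-- ★★ **THE VORTICITY NUMBER OF A DSS FIELD IS ATTAINED.**  Same class (`c`-DSS, `c > 1`, jointly smooth on
`(−∞,0)`, gradient decaying at spatial infinity over the period), with `ω ≢ 0`: the space-time supremum of
`(0 − t)·|ω(t,x)|` over `t < 0`, `x` is attained at some `t_ω < 0`, `x_ω` with `ω(t_ω,x_ω) ≠ 0`. [folklore] -/
theorem dss_vorticityNumber_attained {c : ℝ} (hc : 1 < c)
    {u : ℝ → (EuclideanSpace ℝ (Fin 3)) → (EuclideanSpace ℝ (Fin 3))}
    (hsm : IsSmoothSpaceTimeOn (Iio 0) u) (hdss : IsDiscretelySelfSimilar c u)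
    (hdecay : ∀ ε : ℝ, 0 < ε → ∃ R : ℝ, ∀ t ∈ Icc (-(c ^ 2)) (-1), ∀ x : EuclideanSpace ℝ (Fin 3),
      R ≤ ‖x‖ → ‖fderiv ℝ (u t) x‖ ≤ ε)
    (hcurl : ∃ t₀ : ℝ, t₀ < 0 ∧ ∃ x₀ : EuclideanSpace ℝ (Fin 3), curl (u t₀) x₀ ≠ 0) :
    ∃ t : ℝ, t < 0 ∧ ∃ x : EuclideanSpace ℝ (Fin 3), curl (u t) x ≠ 0 ∧
      ∀ s : ℝ, s < 0 → ∀ y : EuclideanSpace ℝ (Fin 3),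
        (0 - s) * ‖curl (u s) y‖ ≤ (0 - t) * ‖curl (u t) x‖ := by
  have hc0 : 0 < c := one_pos.trans hc
  have hc2 : 0 < c ^ 2 := pow_pos hc0 2
  obtain ⟨t₀, ht₀, x₀, hω₀⟩ := hcurl
  obtain ⟨W₀, hW₀⟩ : ∃ W₀ : ℝ, W₀ = (0 - t₀) * ‖curl (u t₀) x₀‖ := ⟨_, rfl⟩
  have hW₀pos : 0 < W₀ := by rw [hW₀]; exact mul_pos (by linarith) (norm_pos_iff.mpr hω₀)
  have hL : 0 ≤ ‖(curlCLM : (EuclideanSpace ℝ (Fin 3) →L[ℝ] EuclideanSpace ℝ (Fin 3)) →L[ℝ]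
      EuclideanSpace ℝ (Fin 3))‖ := norm_nonneg _
  obtain ⟨L, hLdef⟩ : ∃ L : ℝ, L = ‖(curlCLM : (EuclideanSpace ℝ (Fin 3) →L[ℝ] EuclideanSpace ℝ (Fin 3)) →L[ℝ]
      EuclideanSpace ℝ (Fin 3))‖ := ⟨_, rfl⟩
  rw [← hLdef] at hL
  obtain ⟨R, hR⟩ := hdecay (W₀ / (2 * c ^ 2 * (L + 1))) (by positivity)
  -- `|ω| ≤ ‖curl‖·|∇u|`
  have hray : ∀ (s : ℝ) (y : EuclideanSpace ℝ (Fin 3)), ‖curl (u s) y‖ ≤ L * ‖fderiv ℝ (u s) y‖ := by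
    intro s y; rw [hLdef]; exact norm_curl_le (u s) y
  -- far field
  have hout : ∀ s ∈ Icc (-(c ^ 2)) (-1), ∀ (y : EuclideanSpace ℝ (Fin 3)), R ≤ ‖y‖ →
      (0 - s) * ‖curl (u s) y‖ ≤ W₀ / 2 := by
    intro s hs y hy
    have h1 : ‖curl (u s) y‖ ≤ L * (W₀ / (2 * c ^ 2 * (L + 1))) :=
      (hray s y).trans (mul_le_mul_of_nonneg_left (hR s hs y hy) hL)
    have hs0 : 0 ≤ 0 - s := by linarith [hs.2]
    have hs2 : 0 - s ≤ c ^ 2 := by linarith [hs.1]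
    have hL1 : L * (W₀ / (2 * c ^ 2 * (L + 1))) ≤ (L + 1) * (W₀ / (2 * c ^ 2 * (L + 1))) :=
      mul_le_mul_of_nonneg_right (by linarith) (by positivity)
    calc (0 - s) * ‖curl (u s) y‖ ≤ (0 - s) * ((L + 1) * (W₀ / (2 * c ^ 2 * (L + 1)))) :=
          mul_le_mul_of_nonneg_left (h1.trans hL1) hs0
      _ ≤ c ^ 2 * ((L + 1) * (W₀ / (2 * c ^ 2 * (L + 1)))) :=
          mul_le_mul_of_nonneg_right hs2 (by positivity)
      _ = W₀ / 2 := by field_simp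
  -- period representatives
  have hrep : ∀ s : ℝ, s < 0 → ∀ (y : EuclideanSpace ℝ (Fin 3)),
      ∃ s' ∈ Icc (-(c ^ 2)) (-1), ∃ y' : EuclideanSpace ℝ (Fin 3),
        (0 - s) * ‖curl (u s) y‖ = (0 - s') * ‖curl (u s') y'‖ := by
    intro s hs y
    obtain ⟨n, hn1, hn2⟩ := exists_dss_period_rep hc hs
    exact ⟨(c ^ n) ^ 2 * s, ⟨hn1.le, hn2⟩, (c ^ n) • y, dss_vorticityNumber_zpow hc0.ne' hdss n s y⟩
  -- compact period cylinder
  obtain ⟨K, hK⟩ : ∃ K : Set (ℝ × EuclideanSpace ℝ (Fin 3)),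
      K = Icc (-(c ^ 2)) (-1) ×ˢ closedBall (0 : EuclideanSpace ℝ (Fin 3)) R := ⟨_, rfl⟩
  have hKc : IsCompact K := by rw [hK]; exact isCompact_Icc.prod (isCompact_closedBall _ _)
  have hmemK : ∀ {s : ℝ} {y : EuclideanSpace ℝ (Fin 3)}, s ∈ Icc (-(c ^ 2)) (-1) → ‖y‖ ≤ R →
      (s, y) ∈ K := by
    intro s y hs hy
    rw [hK]; exact mk_mem_prod hs (mem_closedBall_zero_iff.mpr hy)
  have hKsub : ∀ {z : ℝ × EuclideanSpace ℝ (Fin 3)}, z ∈ K → z.1 ∈ Icc (-(c ^ 2)) (-1) ∧ ‖z.2‖ ≤ R := by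
    intro z hz
    rw [hK] at hz
    exact ⟨(mem_prod.mp hz).1, mem_closedBall_zero_iff.mp (mem_prod.mp hz).2⟩
  have hψc : ContinuousOn (fun z : ℝ × EuclideanSpace ℝ (Fin 3) => (0 - z.1) * ‖curl (u z.1) z.2‖) K := by
    have hω : IsSmoothSpaceTimeOn (Iio 0) (vorticity u) :=
      (hsm.fderiv_slice (uniqueDiffOn_Iio 0)).clm_comp curlCLM
    have hWc : ContinuousOn (fun z : ℝ × EuclideanSpace ℝ (Fin 3) => curl (u z.1) z.2) K := by
      refine hω.continuousOn.mono fun z hz => mk_mem_prod ?_ (mem_univ _)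
      exact lt_of_le_of_lt (hKsub hz).1.2 (by norm_num)
    exact (by fun_prop : Continuous fun z : ℝ × EuclideanSpace ℝ (Fin 3) => (0 : ℝ) - z.1).continuousOn.mul
      hWc.norm
  obtain ⟨s₀, hs₀, y₀, hW₀eq⟩ := hrep t₀ ht₀ x₀
  have hy₀ : ‖y₀‖ ≤ R := by
    by_contra hcon
    push Not at hcon
    have := hout s₀ hs₀ y₀ hcon.le
    rw [← hW₀eq, ← hW₀] at this
    linarith
  have h0K : (s₀, y₀) ∈ K := hmemK hs₀ hy₀
  obtain ⟨z, hzK, hmax⟩ := hKc.exists_isMaxOn ⟨(s₀, y₀), h0K⟩ hψc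
  obtain ⟨htI, -⟩ := hKsub hzK
  have ht : z.1 < 0 := lt_of_le_of_lt htI.2 (by norm_num)
  have hW₀le : W₀ ≤ (0 - z.1) * ‖curl (u z.1) z.2‖ := by
    have := isMaxOn_iff.mp hmax (s₀, y₀) h0K
    rw [hW₀, hW₀eq]; exact this
  refine ⟨z.1, ht, z.2, ?_, ?_⟩
  · intro hzero
    rw [hzero, norm_zero, mul_zero] at hW₀le
    linarith
  · intro s hs y
    obtain ⟨s', hs', y', hEq⟩ := hrep s hs y
    rw [hEq]
    by_cases hy : ‖y'‖ ≤ R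
    · exact isMaxOn_iff.mp hmax (s', y') (hmemK hs' hy)
    · push Not at hy
      exact ((hout s' hs' y' hy.le).trans (by linarith)).trans hW₀le

end Summit.NavierStokesRegularity.NavierStokesRegularity.Theorems.StrainDoors
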